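import Summits.QuantumFields.BalabanUV.Beta.GraphComparison
import Summits.QuantumFields.BalabanUV.Beta.SubsolutionMeanValue

/-!
# `Summit.QuantumFields.BalabanUV.Beta.GraphHarmonicExtension` — the DIRICHLET PROBLEM for the free weighted graph Laplacian on a
# finite set of sites carrying a unit supersolution: the margin-free maximum principle, uniqueness, and the HARMONIC EXTENSION of an
# exterior datum (existence by finite-dimensional linear algebra, linearity, locality, constants, order preservation) — step 1a of
# road P3's reduction of the mean-value binder (MV) of O.2 item (ii-b) to ONE pointwise Poisson-kernel bound (generic bond structure)

HONEST FRAMING (page 1 of everything in this cell).  Discharging `FlowStep.BetaPertH` would make Bałaban's ultraviolet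
stability UNCONDITIONAL — a constructive-QFT result; it is NOT the continuum limit and NOT the Clay problem.  This module
discharges nothing of `BetaPertH`; it is [folklore] finite-dimensional linear algebra and order bookkeeping on a finite bond structure,
kernel-checked, by CO-OWNER #3 of binder row D4 (unit `b2b-balaban-beta-d4-p3`, road P3 «reduction road», gen 12).  HONEST DEPENDENCY:
continuum YM on T⁴ ⇐ BetaPertH ∧ nine spine estimates (0/9 proved); BetaPertH ⇐ (D1) ∧ (D4) ∧ CAP+tail; G-an2-4 gates asym, D1 and NE2/3/4.

THE POINT.  After files 12 (`CovariantKato`), 14 (`GraphComparison`), 15a∕15b (`TorusBoxProfile`∕`TorusBoxSupersolution`) and this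
road's `SubsolutionMeanValue`, O.2 item (ii-b) for the MODEL's covariant Laplacian IS the mean-value binder (MV): «every `z ≥ 0` with
`W·z ≤ Nz` on the box `B` has `z(p) ≤ C·r^{−d}·Σ_{B′} z`».  The classical route to (MV) for SUB-harmonic `z` (to which the harmonic
Harnack ∕ mean-value inequalities do not transfer by comparison) is: DOMINATE `z` on each ball by the Poisson integral of its
exterior values, bound the Poisson kernel POINTWISE from near the centre (the harmonic-measure bound — for the simple nearest-neighbour
weights on `ℤ^d` a displayed lemma of the standard texts, e.g. Lawler–Limic, *Random Walk: A Modern Introduction* (2010), Lemma 6.3.7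
p. 130, whose `H_A(x,y)` is «the unique function harmonic on `A` equal to `δ(· − y)` on `∂A`», ibid. Thm 6.2.1 p. 121 and p. 123), and
AVERAGE over radii.  THIS FILE constructs the harmonic extension on any finite bond structure `src, tgt : Bd → St` with weights `c`
(`W(x) = Σ_{tgt b = x} c_b² + Σ_{src b = x} c_b²`, `(Nu)(x) = Σ_{tgt b = x} c_b²·u(src b) + Σ_{src b = x} c_b²·u(tgt b)`, written out as in
files 12∕14) and any finite `B` carrying a NONNEGATIVE UNIT SUPERSOLUTION `w₀` (`1 + Nw₀ ≤ W·w₀` on `B`; file 15b on torus boxes):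
* §1 **`nonpos_of_subsolution_unit`** — the margin-free maximum principle: `W·v ≤ Nv` on `B` and `v ≤ 0` off `B` give `v ≤ 0`
  (file 14's `nonpos_of_strict_subsolution` at `v − ε·w₀`, then `ε ↓ 0`); **`eq_of_harmonic_of_eq_off`** (uniqueness for the
  Dirichlet problem);
* §2 the DIRICHLET SYSTEM `dirSys B` (Laplacian rows on `B`, identity rows off `B`) is an injective, hence surjective, endomorphism of
  `St → ℝ` (`LinearMap.injective_iff_surjective`); so every exterior datum `g` has a HARMONIC EXTENSION **`harmExt B g`** (`= g` off
  `B`, `W·h = Nh` on `B`; a `def` by choice with spec lemmas `harmExt_eq_off` ∕ `harmExt_harmonic`), characterised by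
  `harmExt_unique`, depending on `g` only off `B` (`harmExt_congr_off`), additive ∕ homogeneous ∕ finitely linear (`harmExt_add` ∕
  `harmExt_smul` ∕ `harmExt_sum`), fixing constants (`harmExt_const`), order preserving (`harmExt_nonneg`, `harmExt_mono`).
The Poisson kernel, its representation ∕ mass ∕ support, and the domination of sub-solutions are the sibling `GraphPoissonKernel`.
NOT here: any estimate — the harmonic-measure bound is the residual LEAF; (MV) remains a HYPOTHESIS of the cell (ABSOLUTE RULE).

LOCATORS (shape only, nothing printed asserted; ABSOLUTE RULE): [Balaban1985BackgroundPropagators] Thm 3.1 (3.42) p. 397 (the sup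
member (ii-b) feeds), p. 394 (Dirichlet operators `Ω₀Δ′Ω₀`, `G′`); [Balaban1984PropagatorsII] Prop. 2.2 (2.67) p. 234.  Row D4: NO
class change (critical-path width 0; D4 DISCHARGE NO DATE); NOT BetaPertH, NOT continuum, NOT Clay, NOT summit progress.
-/

open scoped BigOperators
open Finset

namespace Summit.QuantumFields.BalabanUV.Beta.GraphHarmonicExtension

open Summit.QuantumFields.BalabanUV.Beta.GraphComparison (nonpos_of_strict_subsolution)
open Summit.QuantumFields.BalabanUV.Beta.SubsolutionMeanValue (nb_sub nb_smul nb_mono nb_nonneg)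

noncomputable section

variable {St Bd : Type} [Fintype St] [Fintype Bd] [DecidableEq St] (src tgt : Bd → St) (c : Bd → ℝ)

/-! ## §1 The margin-free maximum principle on a set carrying a unit supersolution -/

/-- **MAXIMUM PRINCIPLE WITHOUT MARGIN.**  If `B` carries a nonnegative unit supersolution `w₀` (`1 + Nw₀ ≤ W·w₀` on `B`), then every
`v` with `W·v ≤ Nv` on `B` and `v ≤ 0` off `B` satisfies `v ≤ 0` everywhere: for `ε > 0`, `v − ε·w₀` is a strict sub-solution with
margin `ε`, still `≤ 0` off `B`, so `v ≤ ε·w₀` by file 14; let `ε ↓ 0`. [folklore] -/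
theorem nonpos_of_subsolution_unit (B : Finset St) (w₀ : St → ℝ) (hw₀0 : ∀ y, 0 ≤ w₀ y)
    (hw₀ : ∀ x ∈ B, 1 + ((∑ b ∈ univ.filter (fun b => tgt b = x), c b ^ 2 * w₀ (src b)) +
        ∑ b ∈ univ.filter (fun b => src b = x), c b ^ 2 * w₀ (tgt b)) ≤
      ((∑ b ∈ univ.filter (fun b => tgt b = x), c b ^ 2) + ∑ b ∈ univ.filter (fun b => src b = x), c b ^ 2) * w₀ x)
    (v : St → ℝ)
    (hsub : ∀ x ∈ B, ((∑ b ∈ univ.filter (fun b => tgt b = x), c b ^ 2) + ∑ b ∈ univ.filter (fun b => src b = x), c b ^ 2) * v x ≤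
      ((∑ b ∈ univ.filter (fun b => tgt b = x), c b ^ 2 * v (src b)) + ∑ b ∈ univ.filter (fun b => src b = x), c b ^ 2 * v (tgt b)))
    (hout : ∀ x, x ∉ B → v x ≤ 0) (x : St) : v x ≤ 0 := by
  have key : ∀ ε : ℝ, 0 < ε → v x - ε * w₀ x ≤ 0 := by
    intro ε hε
    refine nonpos_of_strict_subsolution src tgt c B (fun y => v y - ε * w₀ y) hε ?_ ?_ x
    · intro y hy
      have e1 := nb_sub src tgt c v (fun z => ε * w₀ z) y
      have e2 := nb_smul src tgt c ε w₀ y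
      beta_reduce at e1
      rw [e2] at e1
      rw [e1, mul_sub]
      have h1 := hsub y hy
      have h2 := mul_le_mul_of_nonneg_left (hw₀ y hy) hε.le
      have h3 : ((∑ b ∈ univ.filter (fun b => tgt b = y), c b ^ 2) + ∑ b ∈ univ.filter (fun b => src b = y), c b ^ 2) *
          (ε * w₀ y) = ε * (((∑ b ∈ univ.filter (fun b => tgt b = y), c b ^ 2) +
            ∑ b ∈ univ.filter (fun b => src b = y), c b ^ 2) * w₀ y) := by ring
      rw [h3]
      nlinarith
    · intro y hy
      have h1 := hout y hy
      have h2 := mul_nonneg hε.le (hw₀0 y)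
      linarith
  refine le_of_forall_pos_le_add fun ε hε => ?_
  have hε' : 0 < ε / (w₀ x + 1) := div_pos hε (by linarith [hw₀0 x])
  have h := key _ hε'
  have hle : ε / (w₀ x + 1) * w₀ x ≤ ε := by
    rw [div_mul_eq_mul_div, div_le_iff₀ (by linarith [hw₀0 x])]
    nlinarith [hw₀0 x]
  linarith

/-- **UNIQUENESS FOR THE DIRICHLET PROBLEM.**  Two functions harmonic on `B` (`W·u = Nu`) that agree off `B` agree everywhere
(if `B` carries a nonnegative unit supersolution). [folklore] -/
theorem eq_of_harmonic_of_eq_off (B : Finset St) (w₀ : St → ℝ) (hw₀0 : ∀ y, 0 ≤ w₀ y)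
    (hw₀ : ∀ x ∈ B, 1 + ((∑ b ∈ univ.filter (fun b => tgt b = x), c b ^ 2 * w₀ (src b)) +
        ∑ b ∈ univ.filter (fun b => src b = x), c b ^ 2 * w₀ (tgt b)) ≤
      ((∑ b ∈ univ.filter (fun b => tgt b = x), c b ^ 2) + ∑ b ∈ univ.filter (fun b => src b = x), c b ^ 2) * w₀ x)
    (u u' : St → ℝ)
    (hu : ∀ x ∈ B, ((∑ b ∈ univ.filter (fun b => tgt b = x), c b ^ 2) + ∑ b ∈ univ.filter (fun b => src b = x), c b ^ 2) * u x =
      ((∑ b ∈ univ.filter (fun b => tgt b = x), c b ^ 2 * u (src b)) + ∑ b ∈ univ.filter (fun b => src b = x), c b ^ 2 * u (tgt b)))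
    (hu' : ∀ x ∈ B, ((∑ b ∈ univ.filter (fun b => tgt b = x), c b ^ 2) + ∑ b ∈ univ.filter (fun b => src b = x), c b ^ 2) * u' x =
      ((∑ b ∈ univ.filter (fun b => tgt b = x), c b ^ 2 * u' (src b)) + ∑ b ∈ univ.filter (fun b => src b = x), c b ^ 2 * u' (tgt b)))
    (hoff : ∀ x, x ∉ B → u x = u' x) : u = u' := by
  have hd : ∀ x ∈ B, ((∑ b ∈ univ.filter (fun b => tgt b = x), c b ^ 2) + ∑ b ∈ univ.filter (fun b => src b = x), c b ^ 2) *
      (u x - u' x) = ((∑ b ∈ univ.filter (fun b => tgt b = x), c b ^ 2 * (u (src b) - u' (src b))) +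
        ∑ b ∈ univ.filter (fun b => src b = x), c b ^ 2 * (u (tgt b) - u' (tgt b))) := by
    intro x hx
    rw [nb_sub src tgt c u u' x, mul_sub, hu x hx, hu' x hx]
  have h1 := nonpos_of_subsolution_unit src tgt c B w₀ hw₀0 hw₀ (fun y => u y - u' y) (fun x hx => (hd x hx).le)
    (fun x hx => by rw [hoff x hx, sub_self])
  have hd' : ∀ x ∈ B, ((∑ b ∈ univ.filter (fun b => tgt b = x), c b ^ 2) + ∑ b ∈ univ.filter (fun b => src b = x), c b ^ 2) *
      (u' x - u x) = ((∑ b ∈ univ.filter (fun b => tgt b = x), c b ^ 2 * (u' (src b) - u (src b))) +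
        ∑ b ∈ univ.filter (fun b => src b = x), c b ^ 2 * (u' (tgt b) - u (tgt b))) := by
    intro x hx
    rw [nb_sub src tgt c u' u x, mul_sub, hu x hx, hu' x hx]
  have h2 := nonpos_of_subsolution_unit src tgt c B w₀ hw₀0 hw₀ (fun y => u' y - u y) (fun x hx => (hd' x hx).le)
    (fun x hx => by rw [hoff x hx, sub_self])
  funext x
  have := h1 x
  have := h2 x
  linarith

/-! ## §2 The Dirichlet system and the harmonic extension -/

/-- The DIRICHLET SYSTEM of `B`: the free Laplacian rows `W(x)·u(x) − (Nu)(x)` at the sites of `B`, the identity rows off `B` — a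
linear endomorphism of `St → ℝ`. [folklore] -/
def dirSys (B : Finset St) : (St → ℝ) →ₗ[ℝ] (St → ℝ) where
  toFun u x := if x ∈ B then
      ((∑ b ∈ univ.filter (fun b => tgt b = x), c b ^ 2) + ∑ b ∈ univ.filter (fun b => src b = x), c b ^ 2) * u x -
        ((∑ b ∈ univ.filter (fun b => tgt b = x), c b ^ 2 * u (src b)) + ∑ b ∈ univ.filter (fun b => src b = x), c b ^ 2 * u (tgt b))
    else u x
  map_add' u v := by
    funext x
    simp only [Pi.add_apply, mul_add, Finset.sum_add_distrib]
    split_ifs <;> ring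
  map_smul' a u := by
    funext x
    simp only [Pi.smul_apply, smul_eq_mul, RingHom.id_apply]
    split_ifs
    · simp_rw [mul_left_comm (c _ ^ 2) a, ← Finset.mul_sum]
      ring
    · rfl

omit [Fintype St] in
/-- Unfolding of the Dirichlet system. [folklore] -/
theorem dirSys_apply (B : Finset St) (u : St → ℝ) (x : St) :
    dirSys src tgt c B u x = if x ∈ B then
      ((∑ b ∈ univ.filter (fun b => tgt b = x), c b ^ 2) + ∑ b ∈ univ.filter (fun b => src b = x), c b ^ 2) * u x -
        ((∑ b ∈ univ.filter (fun b => tgt b = x), c b ^ 2 * u (src b)) + ∑ b ∈ univ.filter (fun b => src b = x), c b ^ 2 * u (tgt b))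
    else u x := rfl

/-- **The Dirichlet system is injective** when `B` carries a nonnegative unit supersolution (§1 applied to `u` and `−u`). [folklore] -/
theorem dirSys_injective (B : Finset St) (w₀ : St → ℝ) (hw₀0 : ∀ y, 0 ≤ w₀ y)
    (hw₀ : ∀ x ∈ B, 1 + ((∑ b ∈ univ.filter (fun b => tgt b = x), c b ^ 2 * w₀ (src b)) +
        ∑ b ∈ univ.filter (fun b => src b = x), c b ^ 2 * w₀ (tgt b)) ≤
      ((∑ b ∈ univ.filter (fun b => tgt b = x), c b ^ 2) + ∑ b ∈ univ.filter (fun b => src b = x), c b ^ 2) * w₀ x) :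
    Function.Injective (dirSys src tgt c B) := by
  refine (injective_iff_map_eq_zero _).mpr fun u hu => ?_
  have hx := fun x => congrFun hu x
  refine eq_of_harmonic_of_eq_off src tgt c B w₀ hw₀0 hw₀ u 0 (fun x hxB => ?_) (fun x _ => by simp) (fun x hxB => ?_)
  · have h := hx x
    rw [dirSys_apply, if_pos hxB] at h
    exact sub_eq_zero.mp h
  · have h := hx x
    rw [dirSys_apply, if_neg hxB] at h
    exact h

/-- **The Dirichlet system is surjective** (finite dimension). [folklore] -/
theorem dirSys_surjective (B : Finset St) (w₀ : St → ℝ) (hw₀0 : ∀ y, 0 ≤ w₀ y)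
    (hw₀ : ∀ x ∈ B, 1 + ((∑ b ∈ univ.filter (fun b => tgt b = x), c b ^ 2 * w₀ (src b)) +
        ∑ b ∈ univ.filter (fun b => src b = x), c b ^ 2 * w₀ (tgt b)) ≤
      ((∑ b ∈ univ.filter (fun b => tgt b = x), c b ^ 2) + ∑ b ∈ univ.filter (fun b => src b = x), c b ^ 2) * w₀ x) :
    Function.Surjective (dirSys src tgt c B) :=
  LinearMap.injective_iff_surjective.mp (dirSys_injective src tgt c B w₀ hw₀0 hw₀)

open Classical in
/-- **The HARMONIC EXTENSION** of an exterior datum `g` into `B`: the function equal to `g` off `B` and harmonic (`W·h = Nh`) on `B`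
when one exists (it does and is unique when `B` carries a nonnegative unit supersolution: `harmExt_eq_off`, `harmExt_harmonic`,
`eq_of_harmonic_of_eq_off`), else `g` itself.  MODEL object (the tree's counterpart of the Poisson integral `E^x[g(S_τ)]`). [folklore] -/
def harmExt (B : Finset St) (g : St → ℝ) : St → ℝ :=
  if h : ∃ u : St → ℝ, (∀ x, x ∉ B → u x = g x) ∧
      ∀ x ∈ B, ((∑ b ∈ univ.filter (fun b => tgt b = x), c b ^ 2) + ∑ b ∈ univ.filter (fun b => src b = x), c b ^ 2) * u x =
        ((∑ b ∈ univ.filter (fun b => tgt b = x), c b ^ 2 * u (src b)) + ∑ b ∈ univ.filter (fun b => src b = x), c b ^ 2 * u (tgt b))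
    then h.choose else g

section Spec

variable (B : Finset St) (w₀ : St → ℝ) (hw₀0 : ∀ y, 0 ≤ w₀ y)
    (hw₀ : ∀ x ∈ B, 1 + ((∑ b ∈ univ.filter (fun b => tgt b = x), c b ^ 2 * w₀ (src b)) +
        ∑ b ∈ univ.filter (fun b => src b = x), c b ^ 2 * w₀ (tgt b)) ≤
      ((∑ b ∈ univ.filter (fun b => tgt b = x), c b ^ 2) + ∑ b ∈ univ.filter (fun b => src b = x), c b ^ 2) * w₀ x)

include hw₀0 hw₀

/-- Existence for the Dirichlet problem: some `u` equals `g` off `B` and is harmonic on `B`. [folklore] -/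
theorem exists_harmonic_ext (g : St → ℝ) : ∃ u : St → ℝ, (∀ x, x ∉ B → u x = g x) ∧
    ∀ x ∈ B, ((∑ b ∈ univ.filter (fun b => tgt b = x), c b ^ 2) + ∑ b ∈ univ.filter (fun b => src b = x), c b ^ 2) * u x =
      ((∑ b ∈ univ.filter (fun b => tgt b = x), c b ^ 2 * u (src b)) + ∑ b ∈ univ.filter (fun b => src b = x), c b ^ 2 * u (tgt b)) := by
  obtain ⟨u, hu⟩ := dirSys_surjective src tgt c B w₀ hw₀0 hw₀ (fun x => if x ∈ B then 0 else g x)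
  refine ⟨u, fun x hx => ?_, fun x hx => ?_⟩
  · have h := congrFun hu x
    rw [dirSys_apply, if_neg hx] at h
    simp only [hx, if_false] at h
    exact h
  · have h := congrFun hu x
    rw [dirSys_apply, if_pos hx] at h
    simp only [hx, if_true] at h
    exact sub_eq_zero.mp h

/-- `harmExt B g = g` off `B`. [folklore] -/
theorem harmExt_eq_off (g : St → ℝ) (x : St) (hx : x ∉ B) : harmExt src tgt c B g x = g x := by
  have hex := exists_harmonic_ext src tgt c B w₀ hw₀0 hw₀ g
  rw [harmExt, dif_pos hex]
  exact hex.choose_spec.1 x hx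

/-- `harmExt B g` is harmonic on `B`: `W·h = Nh`. [folklore] -/
theorem harmExt_harmonic (g : St → ℝ) (x : St) (hx : x ∈ B) :
    ((∑ b ∈ univ.filter (fun b => tgt b = x), c b ^ 2) + ∑ b ∈ univ.filter (fun b => src b = x), c b ^ 2) *
        harmExt src tgt c B g x =
      ((∑ b ∈ univ.filter (fun b => tgt b = x), c b ^ 2 * harmExt src tgt c B g (src b)) +
        ∑ b ∈ univ.filter (fun b => src b = x), c b ^ 2 * harmExt src tgt c B g (tgt b)) := by
  have hex := exists_harmonic_ext src tgt c B w₀ hw₀0 hw₀ g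
  have e : harmExt src tgt c B g = hex.choose := by rw [harmExt, dif_pos hex]
  rw [e]
  exact hex.choose_spec.2 x hx

/-- **Characterisation**: any `u` equal to `g` off `B` and harmonic on `B` IS `harmExt B g`. [folklore] -/
theorem harmExt_unique (g u : St → ℝ) (hoff : ∀ x, x ∉ B → u x = g x)
    (hu : ∀ x ∈ B, ((∑ b ∈ univ.filter (fun b => tgt b = x), c b ^ 2) + ∑ b ∈ univ.filter (fun b => src b = x), c b ^ 2) * u x =
      ((∑ b ∈ univ.filter (fun b => tgt b = x), c b ^ 2 * u (src b)) + ∑ b ∈ univ.filter (fun b => src b = x), c b ^ 2 * u (tgt b))) :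
    u = harmExt src tgt c B g :=
  eq_of_harmonic_of_eq_off src tgt c B w₀ hw₀0 hw₀ u _ hu (harmExt_harmonic src tgt c B w₀ hw₀0 hw₀ g)
    (fun x hx => by rw [hoff x hx, harmExt_eq_off src tgt c B w₀ hw₀0 hw₀ g x hx])

/-- The harmonic extension depends on the datum only OFF `B`. [folklore] -/
theorem harmExt_congr_off (g g' : St → ℝ) (h : ∀ x, x ∉ B → g x = g' x) :
    harmExt src tgt c B g = harmExt src tgt c B g' :=
  harmExt_unique src tgt c B w₀ hw₀0 hw₀ g' _ (fun x hx => by rw [harmExt_eq_off src tgt c B w₀ hw₀0 hw₀ g x hx, h x hx])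
    (harmExt_harmonic src tgt c B w₀ hw₀0 hw₀ g)

/-- Additivity of the harmonic extension. [folklore] -/
theorem harmExt_add (g g' : St → ℝ) :
    harmExt src tgt c B (fun x => g x + g' x) = fun x => harmExt src tgt c B g x + harmExt src tgt c B g' x := by
  symm
  refine harmExt_unique src tgt c B w₀ hw₀0 hw₀ _ _ (fun x hx => by
    rw [harmExt_eq_off src tgt c B w₀ hw₀0 hw₀ g x hx, harmExt_eq_off src tgt c B w₀ hw₀0 hw₀ g' x hx]) (fun x hx => ?_)
  have h1 := harmExt_harmonic src tgt c B w₀ hw₀0 hw₀ g x hx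
  have h2 := harmExt_harmonic src tgt c B w₀ hw₀0 hw₀ g' x hx
  simp only [mul_add, Finset.sum_add_distrib]
  linarith

/-- Homogeneity of the harmonic extension. [folklore] -/
theorem harmExt_smul (a : ℝ) (g : St → ℝ) :
    harmExt src tgt c B (fun x => a * g x) = fun x => a * harmExt src tgt c B g x := by
  symm
  refine harmExt_unique src tgt c B w₀ hw₀0 hw₀ _ _ (fun x hx => by
    rw [harmExt_eq_off src tgt c B w₀ hw₀0 hw₀ g x hx]) (fun x hx => ?_)
  have h1 := harmExt_harmonic src tgt c B w₀ hw₀0 hw₀ g x hx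
  rw [nb_smul src tgt c a (harmExt src tgt c B g) x, ← h1]
  ring

/-- A finite linear combination passes through the harmonic extension. [folklore] -/
theorem harmExt_sum {ι : Type} (s : Finset ι) (a : ι → ℝ) (g : ι → St → ℝ) :
    harmExt src tgt c B (fun x => ∑ i ∈ s, a i * g i x) = fun x => ∑ i ∈ s, a i * harmExt src tgt c B (g i) x := by
  classical
  induction s using Finset.induction_on with
  | empty =>
      simp only [Finset.sum_empty]
      symm
      refine harmExt_unique src tgt c B w₀ hw₀0 hw₀ _ _ (fun x _ => rfl) (fun x _ => by simp)
  | insert i s hi ih =>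
      simp only [Finset.sum_insert hi]
      rw [show (fun x => a i * g i x + ∑ j ∈ s, a j * g j x) = fun x => (fun y => a i * g i y) x + (fun y => ∑ j ∈ s, a j * g j y) x
        from rfl, harmExt_add src tgt c B w₀ hw₀0 hw₀, harmExt_smul src tgt c B w₀ hw₀0 hw₀, ih]

/-- Constants are their own harmonic extension (`N1 = W`). [folklore] -/
theorem harmExt_const (a : ℝ) : harmExt src tgt c B (fun _ => a) = fun _ => a := by
  symm
  refine harmExt_unique src tgt c B w₀ hw₀0 hw₀ _ _ (fun x _ => rfl) (fun x _ => ?_)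
  rw [add_mul, Finset.sum_mul, Finset.sum_mul]

/-- **Order preservation**: a datum nonnegative off `B` has a nonnegative harmonic extension (§1 at `−harmExt`). [folklore] -/
theorem harmExt_nonneg (g : St → ℝ) (hg : ∀ x, x ∉ B → 0 ≤ g x) (x : St) : 0 ≤ harmExt src tgt c B g x := by
  have h := nonpos_of_subsolution_unit src tgt c B w₀ hw₀0 hw₀ (fun y => -harmExt src tgt c B g y) (fun y hy => ?_)
    (fun y hy => by rw [neg_nonpos, harmExt_eq_off src tgt c B w₀ hw₀0 hw₀ g y hy]; exact hg y hy) x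
  · linarith
  · have h1 := harmExt_harmonic src tgt c B w₀ hw₀0 hw₀ g y hy
    have e := nb_smul src tgt c (-1) (harmExt src tgt c B g) y
    simp only [neg_one_mul] at e
    rw [e, ← h1]
    linarith

/-- Monotonicity of the harmonic extension in the exterior datum. [folklore] -/
theorem harmExt_mono (g g' : St → ℝ) (h : ∀ x, x ∉ B → g x ≤ g' x) (x : St) :
    harmExt src tgt c B g x ≤ harmExt src tgt c B g' x := by
  have hsub : harmExt src tgt c B (fun y => g' y + (-1) * g y) =
      fun y => harmExt src tgt c B g' y + (-1) * harmExt src tgt c B g y := by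
    rw [show (fun y => g' y + (-1) * g y) = fun y => g' y + (fun z => (-1) * g z) y from rfl,
      harmExt_add src tgt c B w₀ hw₀0 hw₀, harmExt_smul src tgt c B w₀ hw₀0 hw₀]
  have h0 := harmExt_nonneg src tgt c B w₀ hw₀0 hw₀ (fun y => g' y + (-1) * g y)
    (fun y hy => by have := h y hy; linarith) x
  rw [hsub] at h0
  simp only at h0
  linarith

end Spec

end

end Summit.QuantumFields.BalabanUV.Beta.GraphHarmonicExtension
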